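import Summits.CriticalPhenomena.SAWScalingLimit.Theorems.SAWTensorRGRestrictionOfLimitSqueezeBite
import Summits.CriticalPhenomena.SAWScalingLimit.Theorems.SAWTensorRGRestrictionOfLimitSqueezeBites
import Summits.CriticalPhenomena.SAWScalingLimit.Theorems.SAWTensorRGRestrictionOfLimitSqueezeChart
import Literature.Probability.RandomPlanarGeometry.CaratheodoryExtension
import HarnessLib

/-!
# Outer squeezes, part 5: the pulled-back closed sub-domain and one level of the squeeze

Support file (`--supports stmt-CriticalPhenomena-0773`, towards the registered stub `stub_squeezeFamily`) of
the line `birth` for the crux `RestrictionOfLimit`. Pure plane topology, no probability.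

For Dobrushin domains `D' ⊆ D` with the same marked points `a, b` and a closed half-plane chart `Ψ` of `D`
punctured at `b` (part 4), the pulled-back set `Kb = {z ∈ ℍ̄ | Ψ z ∈ cl D'}` is closed, connected,
unbounded and has a real point (`Ψ⁻¹ a`), so parts 2–3 apply. Every point of `ℍ̄ ∖ Kb` lies in a component
of the reflected defect through a real point (`exists_real_mem_comp`): otherwise the `Ψ`-image of its
component would be a bounded clopen piece of the connected unbounded exterior `ℂ ∖ cl D'` of the Jordan
curve `∂D'` (Jordan curve theorem, tree: `JordanDomain.isConnected_compl_closure`). Finally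
`exists_dobrushin_level` removes from `D` the `Ψ`-images of finitely many bites lying in distinct
components (bite lemma of part 1, transported by the chart): one level `E t` of the squeeze.
Axioms `propext`, `Classical.choice`, `Quot.sound`.
-/

noncomputable section

open MeasureTheory Filter Topology Set Metric Complex Bornology
open scoped ComplexConjugate
open Literature.Probability.RandomPlanarGeometry Literature.Topology.PlaneTopology

namespace Summit.CriticalPhenomena.SAWScalingLimit.Theorems.RestrictionOfLimit.Birth

/-! ### The pulled-back closed sub-domain `Kb = Ψ⁻¹ (cl D')` -/

section Kb

variable {D D' : DobrushinDomain} (χ : HChart D.toJordanDomain (D.pt 1)) {Kb : Set ℂ}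
  (hKb : Kb = {z : ℂ | 0 ≤ z.im ∧ χ.Ψ z ∈ closure D'.carrier})

/-- The second marked point lies on `∂D' ⊆ cl D'` and not in `D'`. [folklore] -/
theorem pt_mem_frontier' (D' : DobrushinDomain) (i : Fin 2) :
    D'.pt i ∈ frontier D'.carrier ∧ D'.pt i ∉ D'.carrier := by
  refine ⟨D'.boundary_mem_frontier _, fun h ↦ ?_⟩
  have := (D'.boundary_mem_frontier (D'.mark i)).2
  rw [D'.isOpen.interior_eq] at this
  exact this h

include hKb in
/-- Membership in `Kb`. [folklore] -/
theorem mem_kb_iff {z : ℂ} : z ∈ Kb ↔ 0 ≤ z.im ∧ χ.Ψ z ∈ closure D'.carrier := by rw [hKb]; rfl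

include hKb in
/-- `Kb` is closed. [folklore] -/
theorem isClosed_kb : IsClosed Kb := by
  rw [hKb]
  exact χ.continuousOn.preimage_isClosed_of_isClosed (isClosed_le continuous_const continuous_im)
    isClosed_closure

include hKb in
/-- `Kb ⊆ ℍ̄`. [folklore] -/
theorem kb_subset : Kb ⊆ {z | 0 ≤ z.im} := fun _ hz ↦ ((mem_kb_iff χ hKb).1 hz).1

include hKb in
/-- `Kb` is the inverse image of `cl D' ∖ {b}`. [folklore] -/
theorem kb_eq_image (hsub : D'.carrier ⊆ D.carrier) :
    Kb = χ.Ψinv '' (closure D'.carrier \ {D.pt 1}) := by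
  have hcl : closure D'.carrier ⊆ closure D.carrier := closure_mono hsub
  ext z
  rw [mem_kb_iff χ hKb]
  constructor
  · rintro ⟨hz, hzK⟩
    exact ⟨χ.Ψ z, ⟨hzK, χ.apply_ne hz⟩, χ.left_inv z hz⟩
  · rintro ⟨w, ⟨hwK, hwb⟩, rfl⟩
    exact ⟨χ.mapsTo_inv ⟨hcl hwK, hwb⟩, by rw [χ.right_inv w ⟨hcl hwK, hwb⟩]; exact hwK⟩

/-- `cl D' ∖ {b}` is connected (`D' ⊆ cl D' ∖ {b} ⊆ cl D'`). [folklore] -/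
theorem isPreconnected_closure_diff_pt (h1 : D'.pt 1 = D.pt 1) :
    IsPreconnected (closure D'.carrier \ {D.pt 1}) :=
  D'.isConnected.isPreconnected.subset_closure
    (fun _ hz ↦ ⟨subset_closure hz, fun h ↦ (pt_mem_frontier' D' 1).2 (h1 ▸ h ▸ hz)⟩) sdiff_subset

include hKb in
/-- `Kb` is connected. [folklore] -/
theorem isPreconnected_kb (hsub : D'.carrier ⊆ D.carrier) (h1 : D'.pt 1 = D.pt 1) : IsPreconnected Kb := by
  rw [kb_eq_image χ hKb hsub]
  exact (isPreconnected_closure_diff_pt h1).image _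
    (χ.continuousOn_inv.mono fun w hw ↦ ⟨closure_mono hsub hw.1, hw.2⟩)

include hKb in
/-- `Kb` is unbounded (`b` is adherent to `cl D' ∖ {b}`, the homeomorphic image of `Kb`). [folklore] -/
theorem not_isBounded_kb (hsub : D'.carrier ⊆ D.carrier) (h1 : D'.pt 1 = D.pt 1) : ¬ IsBounded Kb := by
  intro hb
  have hcpt : IsCompact Kb := Metric.isCompact_of_isClosed_isBounded (isClosed_kb χ hKb) hb
  have hcl : closure D'.carrier ⊆ closure D.carrier := closure_mono hsub
  have himage : χ.Ψ '' Kb = closure D'.carrier \ {D.pt 1} := by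
    ext w
    constructor
    · rintro ⟨z, hz, rfl⟩
      obtain ⟨hzim, hzK⟩ := (mem_kb_iff χ hKb).1 hz
      exact ⟨hzK, χ.apply_ne hzim⟩
    · intro hw
      have hw' : w ∈ closure D.carrier \ {D.pt 1} := ⟨hcl hw.1, hw.2⟩
      refine ⟨χ.Ψinv w, (mem_kb_iff χ hKb).2 ⟨χ.mapsTo_inv hw', ?_⟩, χ.right_inv w hw'⟩
      rw [χ.right_inv w hw']
      exact hw.1
  have hclosed : IsClosed (closure D'.carrier \ {D.pt 1}) := by
    rw [← himage]
    exact (hcpt.image_of_continuousOn (χ.continuousOn.mono (kb_subset χ hKb))).isClosed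
  have hsub' : D'.carrier ⊆ closure D'.carrier \ {D.pt 1} :=
    fun _ hz ↦ ⟨subset_closure hz, fun h ↦ (pt_mem_frontier' D' 1).2 (h1 ▸ h ▸ hz)⟩
  have hb' : D.pt 1 ∈ closure (closure D'.carrier \ {D.pt 1}) :=
    closure_mono hsub' (h1 ▸ (pt_mem_frontier' D' 1).1.1)
  rw [hclosed.closure_eq] at hb'
  exact hb'.2 rfl

include hKb in
/-- `Kb` has a real point: `Ψ⁻¹ a`. [folklore] -/
theorem exists_real_mem_kb (h0 : D'.pt 0 = D.pt 0) : ∃ x : ℝ, (x : ℂ) ∈ Kb := by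
  have ha : D.pt 0 ∈ closure D.carrier := (D.boundary_mem_frontier _).1
  have hab : D.pt 0 ≠ D.pt 1 := fun h ↦ absurd (D.pt_injective h) (by decide)
  obtain ⟨z, hz, hza⟩ := χ.exists_eq ha hab
  have hzim : z.im = 0 := by
    by_contra h
    have : χ.Ψ z ∈ D.carrier := χ.apply_mem_carrier (lt_of_le_of_ne hz (Ne.symm h))
    rw [hza] at this
    have h2 := (D.boundary_mem_frontier (D.mark 0)).2
    rw [D.isOpen.interior_eq] at h2
    exact h2 this
  refine ⟨z.re, (mem_kb_iff χ hKb).2 ?_⟩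
  have hzre : ((z.re : ℝ) : ℂ) = z := Complex.ext rfl (by simp [hzim])
  rw [hzre, hza, ← h0]
  exact ⟨hz, (pt_mem_frontier' D' 0).1.1⟩

include hKb in
/-- **Every point of the closed defect lies in a component of the reflected defect through a real point**:
otherwise the image of its component would be a bounded clopen piece of the connected unbounded exterior of
the Jordan curve `∂D'`. [folklore] -/
theorem exists_real_mem_comp (h1 : D'.pt 1 = D.pt 1) {z : ℂ} (hz : 0 ≤ z.im) (hzK : z ∉ Kb) :
    ∃ x : ℝ, (x : ℂ) ∈ hat Kb ∧ z ∈ comp Kb x := by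
  have hK : IsClosed Kb := isClosed_kb χ hKb
  have hzhat : z ∈ hat Kb := (mem_hat_iff_of_im_nonneg hz).2 hzK
  set Cz : Set ℂ := connectedComponentIn (hat Kb) z with hCz
  by_cases hreal : ∃ x : ℝ, (x : ℂ) ∈ Cz
  · obtain ⟨x, hx⟩ := hreal
    refine ⟨x, connectedComponentIn_subset _ _ hx, ?_⟩
    rw [comp, ← connectedComponentIn_eq hx]
    exact mem_connectedComponentIn hzhat
  exfalso
  push Not at hreal
  have hCzc : IsConnected Cz := isConnected_connectedComponentIn_iff.2 hzhat
  have hCzo : IsOpen Cz := (isOpen_hat hK).connectedComponentIn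
  -- `Cz ⊆ ℍ`
  have hzpos : 0 < z.im := by
    rcases hz.lt_or_eq with h | h
    · exact h
    · exfalso
      have hzre : ((z.re : ℝ) : ℂ) = z := Complex.ext rfl (by simp [← h])
      have hmem : ((z.re : ℝ) : ℂ) ∈ Cz := by rw [hzre]; exact mem_connectedComponentIn hzhat
      exact hreal z.re hmem
  have hCzH : Cz ⊆ {w | 0 < w.im} := by
    have hcover : Cz ⊆ {w : ℂ | 0 < w.im} ∪ {w : ℂ | w.im < 0} := fun w hw ↦ by
      rcases lt_trichotomy 0 w.im with h | h | h
      · exact Or.inl h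
      · exfalso
        have hwre : ((w.re : ℝ) : ℂ) = w := Complex.ext rfl (by simp [← h])
        have hmem : ((w.re : ℝ) : ℂ) ∈ Cz := by rw [hwre]; exact hw
        exact hreal w.re hmem
      · exact Or.inr h
    rcases hCzc.isPreconnected.subset_or_subset (isOpen_lt continuous_const continuous_im)
      (isOpen_lt continuous_im continuous_const)
      (Set.disjoint_left.2 fun w (h1 : 0 < w.im) (h2 : w.im < 0) ↦ lt_asymm h1 h2) hcover with h | h
    · exact h
    · exact absurd (h (mem_connectedComponentIn hzhat)) (not_lt.2 hz)
  have hCzH' : Cz ⊆ {w | 0 ≤ w.im} := fun w hw ↦ (show 0 < w.im from hCzH hw).le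
  -- its image `G`
  set G : Set ℂ := χ.Ψ '' Cz with hG
  have hGo : IsOpen G := χ.isOpen_image Cz hCzo hCzH
  have hGc : IsConnected G := hCzc.image _ (χ.continuousOn.mono hCzH')
  have hGD : G ⊆ D.carrier := by
    rintro _ ⟨w, hw, rfl⟩; exact χ.apply_mem_carrier (hCzH hw)
  have hGK : Disjoint G (closure D'.carrier) := by
    rw [Set.disjoint_left]
    rintro _ ⟨w, hw, rfl⟩ hwK
    exact (mem_hat_iff_of_im_nonneg (hCzH hw).le).1 (connectedComponentIn_subset _ _ hw)
      ((mem_kb_iff χ hKb).2 ⟨(hCzH hw).le, hwK⟩)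
  have hfrG : frontier G ⊆ closure D'.carrier := by
    intro w hw
    have hwcl : w ∈ closure G := hw.1
    have hwG : w ∉ G := fun h ↦ hw.2 (by rwa [hGo.interior_eq])
    by_cases hwb : w = D.pt 1
    · rw [hwb, ← h1]
      exact (pt_mem_frontier' D' 1).1.1
    · have hwD : w ∈ closure D.carrier := closure_mono hGD hwcl |> fun h ↦ by simpa using h
      set u := χ.Ψinv w with hu
      have huim : 0 ≤ u.im := χ.mapsTo_inv ⟨hwD, hwb⟩
      have huw : χ.Ψ u = w := χ.right_inv w ⟨hwD, hwb⟩
      have hucl : u ∈ closure Cz := χ.inv_mem_closure hCzH' hwD hwb hwcl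
      have huCz : u ∉ Cz := fun h ↦ hwG ⟨u, h, huw⟩
      have hufr : u ∈ frontier Cz := ⟨hucl, by rwa [hCzo.interior_eq]⟩
      have huK : u ∈ Kb := by
        have := frontier_connectedComponentIn_subset_compl hK z hufr
        by_contra h
        exact this ((mem_hat_iff_of_im_nonneg huim).2 h)
      rw [← huw]
      exact ((mem_kb_iff χ hKb).1 huK).2
  -- the exterior of `∂D'`
  obtain ⟨hOc, -⟩ := D'.isConnected_compl_closure JordanCurveTheorem_holds
  have hOunb := D'.not_isBounded_compl_closure
  have hGO : (closure D'.carrier)ᶜ ⊆ G := by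
    refine hOc.isPreconnected.subset_of_closure_inter_subset hGo ?_ ?_
    · obtain ⟨w, hw⟩ := hGc.nonempty
      exact ⟨w, Set.disjoint_left.1 hGK hw, hw⟩
    · intro w ⟨hwcl, hwO⟩
      by_contra hwG
      exact hwO (hfrG ⟨hwcl, by rwa [hGo.interior_eq]⟩)
  exact hOunb ((D.isBounded.subset hGD).subset hGO)

/-! ### One level of the squeeze: finitely many bites removed -/

include hKb in
/-- **One level.** Removing from `D` the `Ψ`-images of finitely many compact bites, lying in pairwise
distinct components of the reflected defect and each cut off by a simple arc with real end-points adherent to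
its open part, leaves a Dobrushin domain with the marked points of `D` (bite lemma of part 1, transported by
the chart). [folklore] -/
theorem exists_dobrushin_level (h0 : D'.pt 0 = D.pt 0) (S : Finset ℕ) (c : ℕ → ℝ) (T Ti A : ℕ → Set ℂ)
    (u v : ℕ → ℂ) (hc : ∀ n ∈ S, ∀ m ∈ S, n ≠ m → comp Kb (c n) ≠ comp Kb (c m))
    (hT : ∀ n ∈ S, IsCompact (T n) ∧ T n ⊆ comp Kb (c n) ∩ {z | 0 ≤ z.im} ∧ A n ⊆ T n ∧
      IsSimpleArc (A n) (u n) (v n) ∧ (u n).im = 0 ∧ (v n).im = 0 ∧ u n ∈ closure (Ti n) ∧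
      v n ∈ closure (Ti n) ∧ (T n ∩ {z | 0 < z.im}) \ A n = Ti n ∧ IsOpen (Ti n) ∧ IsConnected (Ti n) ∧
      Ti n ⊆ {z | 0 < z.im} ∧ (∀ z ∈ A n, z.im = 0 → z = u n ∨ z = v n)) :
    ∃ E : DobrushinDomain, E.carrier = D.carrier \ χ.Ψ '' (⋃ n ∈ S, T n) ∧ E.pt 0 = D.pt 0 ∧
      E.pt 1 = D.pt 1 := by
  have hnotD : ∀ {z : ℂ}, z.im = 0 → χ.Ψ z ∉ D.carrier := fun {z} hz h ↦ by
    have := (χ.apply_mem_frontier hz).2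
    rw [D.isOpen.interior_eq] at this
    exact this h
  -- the open part of a bite, read in `D`
  have hBi : ∀ n ∈ S, (D.carrier ∩ χ.Ψ '' T n) \ χ.Ψ '' A n = χ.Ψ '' Ti n := by
    intro n hn
    obtain ⟨-, hTsub, hAT, -, -, -, -, -, hTi, -, -, hTiH, -⟩ := hT n hn
    ext w
    constructor
    · rintro ⟨⟨hwD, z, hz, rfl⟩, hwA⟩
      have hzim : 0 < z.im := (χ.mem_carrier_iff z (hTsub hz).2).1 hwD
      refine ⟨z, ?_, rfl⟩
      rw [← hTi]
      exact ⟨⟨hz, hzim⟩, fun hzA ↦ hwA ⟨z, hzA, rfl⟩⟩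
    · rintro ⟨z, hz, rfl⟩
      have hz' : z ∈ (T n ∩ {z | 0 < z.im}) \ A n := by rwa [hTi]
      refine ⟨⟨χ.apply_mem_carrier (hTiH hz), z, hz'.1.1, rfl⟩, ?_⟩
      rintro ⟨z', hz'A, hzz'⟩
      have : z' = z := χ.injOn (hTsub (hAT hz'A)).2 (hTsub hz'.1.1).2 hzz'
      exact hz'.2 (this ▸ hz'A)
  have hopen : ∀ n ∈ S, IsOpen ((D.carrier ∩ χ.Ψ '' T n) \ χ.Ψ '' A n) := fun n hn ↦ by
    rw [hBi n hn]
    exact χ.isOpen_image _ (hT n hn).2.2.2.2.2.2.2.2.2.1 (hT n hn).2.2.2.2.2.2.2.2.2.2.2.1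
  have hconn : ∀ n ∈ S, IsConnected ((D.carrier ∩ χ.Ψ '' T n) \ χ.Ψ '' A n) := fun n hn ↦ by
    rw [hBi n hn]
    exact (hT n hn).2.2.2.2.2.2.2.2.2.2.1.image _ (χ.continuousOn.mono fun z hz ↦
      (show 0 < z.im from (hT n hn).2.2.2.2.2.2.2.2.2.2.2.1 hz).le)
  have ha : ∀ n ∈ S, D.pt 0 ∉ χ.Ψ '' T n := by
    rintro n hn ⟨z, hz, hza⟩
    have hzT := (hT n hn).2.1 hz
    have hzK : z ∈ Kb := (mem_kb_iff χ hKb).2 ⟨hzT.2, by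
      rw [hza, ← h0]; exact (pt_mem_frontier' D' 0).1.1⟩
    exact (mem_hat_iff_of_im_nonneg hzT.2).1 (comp_subset _ hzT.1) hzK
  have hb : ∀ n ∈ S, D.pt 1 ∉ χ.Ψ '' T n := by
    rintro n hn ⟨z, hz, hzb⟩
    exact χ.apply_ne ((hT n hn).2.1 hz).2 hzb
  have hucl : ∀ n ∈ S, χ.Ψ (u n) ∈ closure ((D.carrier ∩ χ.Ψ '' T n) \ χ.Ψ '' A n) := by
    intro n hn
    rw [hBi n hn]
    obtain ⟨-, -, -, -, hu, -, hucl, -, -, -, -, hTiH, -⟩ := hT n hn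
    exact ((χ.continuousOn (u n) hu.ge).mono fun z hz ↦ (show 0 < z.im from hTiH hz).le).mem_closure_image
      hucl
  have hvcl : ∀ n ∈ S, χ.Ψ (v n) ∈ closure ((D.carrier ∩ χ.Ψ '' T n) \ χ.Ψ '' A n) := by
    intro n hn
    rw [hBi n hn]
    obtain ⟨-, -, -, -, -, hv, -, hvcl, -, -, -, hTiH, -⟩ := hT n hn
    exact ((χ.continuousOn (v n) hv.ge).mono fun z hz ↦ (show 0 < z.im from hTiH hz).le).mem_closure_image
      hvcl
  have hLD : ∀ n ∈ S, χ.Ψ '' A n \ {χ.Ψ (u n), χ.Ψ (v n)} ⊆ D.carrier := by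
    rintro n hn _ ⟨⟨z, hz, rfl⟩, hne⟩
    obtain ⟨-, hTsub, hAT, -, -, -, -, -, -, -, -, -, hends⟩ := hT n hn
    have hzim : 0 ≤ z.im := (hTsub (hAT hz)).2
    rcases hzim.lt_or_eq with h | h
    · exact χ.apply_mem_carrier h
    · exfalso
      rcases hends z hz h.symm with rfl | rfl
      · exact hne (Or.inl rfl)
      · exact hne (Or.inr rfl)
  have hdisj : ∀ n ∈ S, ∀ m ∈ S, n ≠ m → Disjoint (χ.Ψ '' T n) (χ.Ψ '' T m) := by
    intro n hn m hm hnm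
    rw [Set.disjoint_left]
    rintro _ ⟨z, hz, rfl⟩ ⟨z', hz', hzz'⟩
    have hzT := (hT n hn).2.1 hz
    have hz'T := (hT m hm).2.1 hz'
    have : z' = z := χ.injOn hz'T.2 hzT.2 hzz'
    rw [this] at hz'T
    exact hc n hn m hm hnm ((connectedComponentIn_eq hzT.1).trans (connectedComponentIn_eq hz'T.1).symm)
  obtain ⟨E, hE, hE0, hE1⟩ := exists_dobrushin_carrier_eq_diff_biUnion D S (fun n ↦ χ.Ψ '' T n)
    (fun n ↦ χ.Ψ '' A n) (fun n ↦ χ.Ψ (u n)) (fun n ↦ χ.Ψ (v n))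
    (fun n hn ↦ ((hT n hn).1.image_of_continuousOn (χ.continuousOn.mono fun z hz ↦
      ((hT n hn).2.1 hz).2)).isClosed)
    ha hb (fun n hn ↦ image_mono (hT n hn).2.2.1)
    (fun n hn ↦ χ.isSimpleArc_image (hT n hn).2.2.2.1 fun z hz ↦ ((hT n hn).2.1 ((hT n hn).2.2.1 hz)).2)
    (fun n hn ↦ hnotD (hT n hn).2.2.2.2.1) (fun n hn ↦ hnotD (hT n hn).2.2.2.2.2.1)
    hucl hvcl hLD hopen hconn hdisj
  refine ⟨E, ?_, hE0, hE1⟩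
  simp only [hE, image_iUnion₂]

end Kb

/-- **Registered helper stub `stub_squeezeKb`** (towards `stub_squeezeFamily`, line `birth`): the closed
sub-domain punctured at a marked point is connected, in closed form. [folklore] -/
theorem stub_squeezeKb :
    ∀ (D D' : DobrushinDomain), D'.pt 1 = D.pt 1 → IsPreconnected (closure D'.carrier \ {D.pt 1}) :=
  fun _ _ h1 ↦ isPreconnected_closure_diff_pt h1

end Summit.CriticalPhenomena.SAWScalingLimit.Theorems.RestrictionOfLimit.Birth

end
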